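import Literature.NumberTheory.EllipticCurves.NeronModelAbelianScheme
import Literature.NumberTheory.EllipticCurves.NeronModelExtensionSetup
import Literature.AlgebraicGeometry.Morphisms.FlatBirationalOpenImmersion
import HarnessLib

/-!
# A flat separated morphism of flat `R`-schemes which is an isomorphism on generic fibres is an
# open immersion (`R` a discrete valuation ring; Stacks 081M over the generic point)

Topic `Literature/NumberTheory/EllipticCurves` (Néron-model currency `specGenericPoint` / `genericFibre`), namespace
`Literature.NumberTheory.EllipticCurves`.  THEOREMS ONLY (0 def / fact / instance).  Cell `hodgecm-mathlib`, road W (r₀) leaf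
(W0) L5 «081M application» (B-p18 `W0-SPEC.md` §1 (P4)): for `R` a discrete valuation ring with fraction field `K`, `V`, `Y`
schemes over `Spec R` with `V` FLAT over `R`, and an `R`-morphism `Φ : V → Y` which is separated, flat, locally of finite
presentation and whose generic fibre `Φ_K : V_K → Y_K` is an ISOMORPHISM, `Φ` is an OPEN IMMERSION.  Proof: the generic fibre
`Y_K ⊆ Y` is the open `U = Y ×_R Spec K` (`Spec K → Spec R` is an open immersion for a dvr, ★ `isOpenImmersion_specGenericPoint`);
`Φ⁻¹(U) = V_K ↪ V` is quasi-compact (base change of the affine `Spec K → Spec R`) and schematically dominant (`V` flat over `R`,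
★ `isSchemeTheoreticallyDominant_pullback_fst_specGenericPoint`); `Φ|_U ≅ Φ_K` is an isomorphism; conclude by ★ Stacks 081M
`Morphisms.isOpenImmersion_of_flat_of_isIso_morphismRestrict`.  In (W0) this is applied to `Φ = (pr₁, m)` and `Ψ = (m, pr₂)` on
the open `V ⊆ 𝒳 ⊗ 𝒳` where they are flat, whose generic fibres are the shear ISOMORPHISMS of the group `E = 𝒳_K`
(`Literature.AlgebraicGeometry.GroupSchemes.isIso_lift_fst_mul` / `isIso_lift_mul_snd`).
HC_CM is proved only modulo the 7 printed citations until rung 0 closes; banked leaf, no floor change.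

## References
* [StacksProject] The Stacks Project, Tag 081M (More on Flatness, Lemma 38.11.5).
* [BLRNeronModels1990] S. Bosch, W. Lütkebohmert, M. Raynaud, *Néron Models* (1990), §4.3 Prop. 1 / §5.1 (birational group laws:
  «`Φ` and `Ψ` are open immersions»), §2.5 Prop. 4 (flat + generic isomorphism).
-/

noncomputable section

set_option backward.isDefEq.respectTransparency false

universe u

namespace Literature.NumberTheory.EllipticCurves

open _root_.AlgebraicGeometry CategoryTheory CategoryTheory.Limits

variable (R : Type u) [CommRing R] [IsDomain R] [IsDiscreteValuationRing R] (K : Type u) [Field K] [Algebra R K]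
  [IsFractionRing R K]

/-- **The generic fibre of an `R`-scheme, `R` a dvr, as an open subscheme**: for `𝒳 → Spec R` the open
`U₀ = 𝒳 ×_R D(ϖ) ⊆ 𝒳` (preimage of the open generic point) is isomorphic to `𝒳_K = 𝒳 ×_R Spec K` over `𝒳`:
there is `e : 𝒳_K ≅ U₀` with `e.hom ≫ U₀.ι = pr₁`. [cite: BLRNeronModels1990, §1.2 (the generic fibre)] -/
theorem exists_iso_pullback_specGenericPoint_opens (𝒳 : Over (Spec (.of R))) :
    ∃ e : pullback 𝒳.hom (specGenericPoint R K) ≅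
        ((𝒳.hom ⁻¹ᵁ (Scheme.Hom.opensRange (specGenericPoint R K) (H :=
          isOpenImmersion_specGenericPoint R K))) : Scheme.{u}),
      e.hom ≫ (𝒳.hom ⁻¹ᵁ (Scheme.Hom.opensRange (specGenericPoint R K) (H :=
          isOpenImmersion_specGenericPoint R K))).ι = pullback.fst 𝒳.hom (specGenericPoint R K) := by
  haveI := isOpenImmersion_specGenericPoint R K
  have hrange : Set.range (pullback.fst 𝒳.hom (specGenericPoint R K)).base =
      Set.range (𝒳.hom ⁻¹ᵁ Scheme.Hom.opensRange (specGenericPoint R K)).ι.base := by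
    rw [Scheme.Opens.range_ι]
    exact IsOpenImmersion.range_pullbackFst (specGenericPoint R K) 𝒳.hom
  exact ⟨IsOpenImmersion.isoOfRangeEq _ _ hrange, IsOpenImmersion.isoOfRangeEq_hom_fac _ _ _⟩

/-- **Stacks 081M over the generic point of a dvr** (the shape of B-p18's (W0) `stub_L5`): let `R` be a discrete valuation
ring with fraction field `K`, `Φ : V → Y` a morphism of `R`-schemes with `V` flat over `R`, `Φ` separated, flat and locally of
finite presentation, and an isomorphism over the generic fibre `U = Y ×_R D(ϖ) ⊆ Y` of the target (`IsIso (Φ ∣_ U)`).  Then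
`Φ` is an open immersion: `Φ⁻¹ U = V_K ↪ V` is quasi-compact and schematically dominant (flatness of `V`), so ★ 081M applies.
[cite: StacksProject, Tag 081M] [cite: BLRNeronModels1990, §2.5 Prop. 4 and §4.3] -/
theorem isOpenImmersion_of_flat_of_isIso_morphismRestrict_genericFibre {V Y : Over (Spec (.of R))} (Φ : V ⟶ Y)
    [Flat V.hom] [IsSeparated Φ.left] [Flat Φ.left] [LocallyOfFinitePresentation Φ.left]
    [IsIso (Φ.left ∣_ (Y.hom ⁻¹ᵁ Scheme.Hom.opensRange (specGenericPoint R K)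
      (H := isOpenImmersion_specGenericPoint R K)))] :
    IsOpenImmersion Φ.left := by
  haveI := isOpenImmersion_specGenericPoint R K
  let U : Y.left.Opens := Y.hom ⁻¹ᵁ Scheme.Hom.opensRange (specGenericPoint R K)
  have hU : Φ.left ⁻¹ᵁ U = V.hom ⁻¹ᵁ Scheme.Hom.opensRange (specGenericPoint R K) := by
    change (Φ.left ≫ Y.hom) ⁻¹ᵁ Scheme.Hom.opensRange (specGenericPoint R K) = _
    rw [Over.w Φ]
  have hrangeV : Set.range (pullback.fst V.hom (specGenericPoint R K)).base =
      Set.range (Φ.left ⁻¹ᵁ U).ι.base := by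
    rw [Scheme.Opens.range_ι, hU]
    exact IsOpenImmersion.range_pullbackFst (specGenericPoint R K) V.hom
  have heV : (IsOpenImmersion.isoOfRangeEq _ _ hrangeV).inv ≫ pullback.fst V.hom (specGenericPoint R K) =
      (Φ.left ⁻¹ᵁ U).ι :=
    IsOpenImmersion.isoOfRangeEq_inv_fac _ _ _
  -- `Φ⁻¹ U ↪ V` is quasi-compact and schematically dominant (`V` flat over `R`)
  haveI : QuasiCompact (Φ.left ⁻¹ᵁ U).ι := by
    rw [← heV]; infer_instance
  haveI : IsSchemeTheoreticallyDominant (Φ.left ⁻¹ᵁ U).ι := by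
    haveI := isSchemeTheoreticallyDominant_pullback_fst_specGenericPoint R K V
    rw [← heV]; infer_instance
  exact Literature.AlgebraicGeometry.Morphisms.isOpenImmersion_of_flat_of_isIso_morphismRestrict Φ.left U

/-- **The restriction of an `R`-morphism over the generic-fibre open is its generic fibre**: if the generic fibre
`Φ_K : V_K → Y_K` (Mathlib `Over.pullback` along `Spec K → Spec R`) is an isomorphism, so is the restriction
`Φ ∣_ U` of `Φ` over the open `U = Y ×_R D(ϖ) ⊆ Y` (`R` a dvr) — the two are isomorphic over `U ≅ Y_K`
(`exists_iso_pullback_specGenericPoint_opens`). [cite: BLRNeronModels1990, §1.2 (the generic fibre)] -/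
theorem isIso_morphismRestrict_genericFibre_of_isIso {V Y : Over (Spec (.of R))} (Φ : V ⟶ Y)
    [IsIso ((genericFibre R K).map Φ).left] :
    IsIso (Φ.left ∣_ (Y.hom ⁻¹ᵁ Scheme.Hom.opensRange (specGenericPoint R K)
      (H := isOpenImmersion_specGenericPoint R K))) := by
  haveI := isOpenImmersion_specGenericPoint R K
  let U : Y.left.Opens := Y.hom ⁻¹ᵁ Scheme.Hom.opensRange (specGenericPoint R K)
  have hU : Φ.left ⁻¹ᵁ U = V.hom ⁻¹ᵁ Scheme.Hom.opensRange (specGenericPoint R K) := by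
    change (Φ.left ≫ Y.hom) ⁻¹ᵁ Scheme.Hom.opensRange (specGenericPoint R K) = _
    rw [Over.w Φ]
  obtain ⟨eY, heY⟩ := exists_iso_pullback_specGenericPoint_opens R K Y
  have hrangeV : Set.range (pullback.fst V.hom (specGenericPoint R K)).base =
      Set.range (Φ.left ⁻¹ᵁ U).ι.base := by
    rw [Scheme.Opens.range_ι, hU]
    exact IsOpenImmersion.range_pullbackFst (specGenericPoint R K) V.hom
  let eV : pullback V.hom (specGenericPoint R K) ≅ (↑(Φ.left ⁻¹ᵁ U) : Scheme.{u}) :=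
    IsOpenImmersion.isoOfRangeEq _ _ hrangeV
  have heV : eV.inv ≫ pullback.fst V.hom (specGenericPoint R K) = (Φ.left ⁻¹ᵁ U).ι :=
    IsOpenImmersion.isoOfRangeEq_inv_fac _ _ _
  have hsq : ((genericFibre R K).map Φ).left ≫ pullback.fst Y.hom (specGenericPoint R K) =
      pullback.fst V.hom (specGenericPoint R K) ≫ Φ.left := by
    simp [Over.pullback_map_left]
  let c : (↑(Φ.left ⁻¹ᵁ U) : Scheme.{u}) ⟶ (U : Scheme.{u}) :=
    eV.inv ≫ ((genericFibre R K).map Φ).left ≫ eY.hom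
  have hc : c ≫ U.ι = (Φ.left ∣_ U) ≫ U.ι := by
    rw [morphismRestrict_ι, ← heV]
    simp only [c, Category.assoc]
    rw [heY, hsq]
  change IsIso (Φ.left ∣_ U)
  rw [← (cancel_mono U.ι).1 hc]
  infer_instance

/-- **Stacks 081M over the generic point, generic-fibre form**: `R` a dvr with fraction field `K`, `Φ : V → Y` a morphism of
`R`-schemes with `V` flat over `R`, `Φ` separated, flat and locally of finite presentation, and generic fibre `Φ_K : V_K → Y_K`
an isomorphism ⟹ `Φ` is an open immersion. [cite: StacksProject, Tag 081M] [cite: BLRNeronModels1990, §2.5 Prop. 4 and §4.3] -/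
theorem isOpenImmersion_of_flat_of_isIso_genericFibre {V Y : Over (Spec (.of R))} (Φ : V ⟶ Y)
    [IsSeparated Φ.left] [Flat Φ.left] [LocallyOfFinitePresentation Φ.left] [Flat V.hom]
    [IsIso ((genericFibre R K).map Φ).left] : IsOpenImmersion Φ.left := by
  haveI := isIso_morphismRestrict_genericFibre_of_isIso R K Φ
  exact isOpenImmersion_of_flat_of_isIso_morphismRestrict_genericFibre R K Φ

end Literature.NumberTheory.EllipticCurves

end
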